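import Mathlib
import HarnessLib

/-!
# Burkholder's exponential inequality for differentially subordinate martingales (LNM 1464, Thm. 8.1)

Probability/Process file of DEFINITIONS and NAMED FACTS (`def … : Prop`, nothing asserted; D-0014),
vendored at the request of the pub-nsfunc cell (laminate-tree certificates: down a divergence-free
laminate tree `(ω, √2 S)` is a martingale pair with `|d(√2 S)| = |dω|`, so Burkholder's theorems for
differentially subordinate martingales apply). Search for candidate a priori estimates; no
regularity claim.

* `IsDifferentiallySubordinate f g` — Burkholder's (3.1): the difference sequences satisfy
  `‖e_k(ω)‖ ≤ ‖d_k(ω)‖` for all `ω` and `k ≥ 0` (`d₀ = f₀`, `e₀ = g₀`).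
* `burkholderAlpha = e²/4` and `burkholderU λ x y` — the explicit five-piece function `u` of the
  proof of Thm. 8.1 for a Hilbert space of real dimension `≥ 2` (LNM 1464, §8, display after (8.8)),
  on `S = {‖x‖ ≤ 1}`: `u = 0` (`‖x‖ = 1`, `‖y‖ < λ`), `u = 1` (`‖x‖ = 1`, `‖y‖ ≥ λ`), and on the
  interior the formulas on `D₀, …, D₄` (glued continuously, as printed: "the restriction of `u` to
  the interior of `S` is continuous"; print defines `D₁, D₂, D₃` with `0 < |x| < 1` — the points
  `|x| = 0` are covered by that continuity clause); outside `S` the definition is immaterial.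
* FACT `Burkholder1991_thm81` — Thm. 8.1, case `λ > 2`: `P(g* ≥ λ) ≤ (e²/4)e^{-λ}` for `H`-valued
  martingales `f, g` w.r.t. the same filtration with `g` differentially subordinate to `f` and
  `‖f‖_∞ ≤ 1` (printed with `<`; the cases `0 < λ ≤ 2` — bounds `1`, `1/λ²` — are not vendored).
* FACT `Burkholder1991_keyFunction` — the three printed properties of `u` from the proof of (8.1)
  (real dimension of `H` at least two, `λ > 2`): (8.6) `E u(f_n, g_n) ≤ E u(f_{n-1}, g_{n-1})`,
  (8.7) `E u(f_0, g_0) ≤ αe^{-λ}`, and the concavity of `t ↦ u(x + th, y + tk)` on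
  `I = {t : ‖x + th‖ ≤ 1}` for `(x, y) ∈ S`, `‖k‖ < ‖h‖` ("The function `G` is concave on `I`").
PROVED here: `burkholderU_zero_zero` (`u(0,0) = αe^{-λ}`), the majorisation
`burkholderU_eq_one` (`u = 1` on `{‖x‖ ≤ 1, ‖y‖ ≥ λ}`, the content of (8.5)), and — an elementary
property of the printed closed forms at `x = 0`, not stated in print — the monotonicity of
`u(0, y)` in `‖y‖` (`burkholderU_zero_mono`) with `0 ≤ u(0, y) ≤ 1` (`burkholderU_zero_mem_Icc`),
and `0 ≤ u ≤ 1` on `S` (`burkholderU_mem_Icc`).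
Not vendored: the supergradient inequality (8.10) itself (its fields `φ, ψ` are extended to the
region boundaries "by continuity" in print).
LATER (2026-08-20, append-only note): the concavity clause of `Burkholder1991_keyFunction` is the
THEOREM `burkholderU_concaveOn` (`BurkholderConcavity.lean`), (8.10) is the THEOREM
`Burkholder1991.burkholderU_le_supergradient` (`BurkholderSupergradient.lean`, where `φ, ψ` are
DEFINED as `phiCoef • x`, `psiCoef • y`), and the whole fact is discharged:
`Burkholder1991_keyFunction_holds` (`BurkholderKeyFunctionProofs.lean`).

## References

* [Burkholder1991] D. L. Burkholder, *Explorations in martingale theory and its applications*,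
  École d'Été de Probabilités de Saint-Flour XIX—1989, Lecture Notes in Math. 1464, Springer 1991,
  pp. 1–66 — §3 (3.1) (differential subordination), §8 Thm. 8.1 and its proof (8.1)–(8.16).
-/

noncomputable section

open MeasureTheory Set Filter Topology
open scoped ENNReal NNReal

namespace Literature.Probability.Process

/-! ## Definitions -/

/-- **Differential subordination** (Burkholder, LNM 1464, (3.1)): for sequences `f g : ℕ → Ω → E`
with difference sequences `d₀ = f₀, d_{k+1} = f_{k+1} - f_k` and `e` likewise, `g` is
differentially subordinate to `f` if `‖e_k(ω)‖ ≤ ‖d_k(ω)‖` for all `ω` and all `k ≥ 0`.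
[cite: Burkholder1991, §3 (3.1)] -/
def IsDifferentiallySubordinate {Ω E : Type*} [NormedAddCommGroup E] (f g : ℕ → Ω → E) : Prop :=
  (∀ ω, ‖g 0 ω‖ ≤ ‖f 0 ω‖) ∧ ∀ n ω, ‖g (n + 1) ω - g n ω‖ ≤ ‖f (n + 1) ω - f n ω‖

/-- Unfolding of `IsDifferentiallySubordinate`. [cite: Burkholder1991, §3 (3.1)] -/
theorem isDifferentiallySubordinate_iff {Ω E : Type*} [NormedAddCommGroup E] (f g : ℕ → Ω → E) :
    IsDifferentiallySubordinate f g ↔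
      (∀ ω, ‖g 0 ω‖ ≤ ‖f 0 ω‖) ∧ ∀ n ω, ‖g (n + 1) ω - g n ω‖ ≤ ‖f (n + 1) ω - f n ω‖ :=
  Iff.rfl

/-- A sequence is differentially subordinate to itself ((3.1) "is satisfied for transforms",
`ε_k = 1`). [cite: Burkholder1991, §3 after (3.1)] -/
theorem IsDifferentiallySubordinate.refl {Ω E : Type*} [NormedAddCommGroup E] (f : ℕ → Ω → E) :
    IsDifferentiallySubordinate f f :=
  ⟨fun _ => le_rfl, fun _ _ => le_rfl⟩

/-- Burkholder's constant `α = e²/4`. [cite: Burkholder1991, §8 Thm. 8.1] -/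
def burkholderAlpha : ℝ := Real.exp 2 / 4

/-- `α = e²/4 > 0`. [cite: Burkholder1991, §8 Thm. 8.1] -/
theorem burkholderAlpha_pos : 0 < burkholderAlpha := by
  unfold burkholderAlpha; positivity

/-- **Burkholder's explicit majorant `u = u_λ`** (LNM 1464, §8, proof of (8.1), the function for a
Hilbert space of real dimension at least two), on `S = {(x, y) : ‖x‖ ≤ 1}`:
`u = 0` if `‖x‖ = 1, ‖y‖ < λ`; `u = 1` if `‖x‖ = 1, ‖y‖ ≥ λ`; and for `‖x‖ < 1`
* `α(1 + ‖y‖² - ‖x‖²)e^{-λ}` on `D₀ = {‖x‖ + ‖y‖ < 1}`,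
* `2α(1 - ‖x‖)e^{‖x‖ + ‖y‖ - λ - 1}` on `D₁ = {1 < ‖x‖ + ‖y‖ < λ - 1}` (print: and `0 < ‖x‖ < 1`;
  `‖x‖ = 0` by continuity — the same closed form),
* `(1 - ‖x‖²)/((λ - ‖y‖)² + 1 - ‖x‖²)` on `D₂ = {λ - 1 - ‖x‖ < ‖y‖ < λ - 1 + ‖x‖}`,
* `1 - (λ² - 1 - ‖y‖² + ‖x‖²)/(4(λ - 1))` on `D₃ = {λ - 1 + ‖x‖ < ‖y‖ < √(λ² - 1 + ‖x‖²)}`,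
* `1` on `D₄ = {‖y‖ > √(λ² - 1 + ‖x‖²)}`,
the pieces being glued along the common boundaries (where consecutive formulas agree, `α = e²/4`;
printed: "the restriction of `u` to the interior of `S` is continuous"). Outside `S` the value is
immaterial (the same case split is used). [cite: Burkholder1991, §8, proof of (8.1), display after (8.8)] -/
def burkholderU {E : Type*} [NormedAddCommGroup E] (lam : ℝ) (x y : E) : ℝ :=
  if ‖x‖ = 1 then (if lam ≤ ‖y‖ then 1 else 0)
  else if lam ^ 2 - 1 + ‖x‖ ^ 2 < ‖y‖ ^ 2 then 1
  else if lam - 1 + ‖x‖ ≤ ‖y‖ then 1 - (lam ^ 2 - 1 - ‖y‖ ^ 2 + ‖x‖ ^ 2) / (4 * (lam - 1))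
  else if lam - 1 - ‖x‖ ≤ ‖y‖ then (1 - ‖x‖ ^ 2) / ((lam - ‖y‖) ^ 2 + 1 - ‖x‖ ^ 2)
  else if 1 ≤ ‖x‖ + ‖y‖ then 2 * burkholderAlpha * (1 - ‖x‖) * Real.exp (‖x‖ + ‖y‖ - lam - 1)
  else burkholderAlpha * (1 + ‖y‖ ^ 2 - ‖x‖ ^ 2) * Real.exp (-lam)

/-- `u(0, 0) = αe^{-λ}` (`λ > 2`; the value giving the bound of Thm. 8.1).
[cite: Burkholder1991, §8, (8.7)] -/
theorem burkholderU_zero_zero {E : Type*} [NormedAddCommGroup E] {lam : ℝ} (hlam : 2 < lam) :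
    burkholderU lam (0 : E) (0 : E) = burkholderAlpha * Real.exp (-lam) := by
  unfold burkholderU
  rw [norm_zero]
  rw [if_neg (by norm_num), if_neg (not_lt.2 (by nlinarith)), if_neg (not_le.2 (by linarith)),
    if_neg (not_le.2 (by linarith)), if_neg (by norm_num)]
  ring

/-- **Majorisation** (the content of (8.5)): `u = 1` on `{‖x‖ ≤ 1, ‖y‖ ≥ λ}` (`λ > 2`).
[cite: Burkholder1991, §8, (8.5)] -/
theorem burkholderU_eq_one {E : Type*} [NormedAddCommGroup E] {lam : ℝ} (hlam : 2 < lam) {x y : E}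
    (hx : ‖x‖ ≤ 1) (hy : lam ≤ ‖y‖) : burkholderU lam x y = 1 := by
  unfold burkholderU
  by_cases h1 : ‖x‖ = 1
  · simp [h1, hy]
  · have hx1 : ‖x‖ < 1 := lt_of_le_of_ne hx h1
    have h2 : lam ^ 2 - 1 + ‖x‖ ^ 2 < ‖y‖ ^ 2 := by
      have hx2 : ‖x‖ ^ 2 < 1 := by nlinarith [norm_nonneg x]
      have hy2 : lam ^ 2 ≤ ‖y‖ ^ 2 := by nlinarith
      linarith
    simp [h1, h2]

/-! ## Named facts -/

/-- **Burkholder's exponential inequality** (LNM 1464, Thm. 8.1, case `λ > 2`). Let `f` and `g`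
be `H`-valued martingales with respect to the same filtration (`H` a real Hilbert space; a complex
one is a real one by restriction of scalars), indexed by `ℕ`, on a probability space. If `g` is
differentially subordinate to `f` and `‖f‖_∞ ≤ 1` (`‖f_n(ω)‖ ≤ 1` for all `n, ω`), then for every
`λ > 2`, `P(g* ≥ λ) ≤ αe^{-λ}`, `α = e²/4`, `g* = sup_n ‖g_n‖` (printed with strict inequality;
here for the event `{∃ n, ‖g_n‖ ≥ λ} ⊆ {g* ≥ λ}`). Printed also: `P(g* ≥ λ) ≤ 1` (`0 < λ ≤ 1`),
`≤ 1/λ²` (`1 < λ ≤ 2`), all sharp — not vendored. Users take `(h : Burkholder1991_thm81)`.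
[cite: Burkholder1991, §8 Thm. 8.1] -/
def Burkholder1991_thm81 : Prop :=
  ∀ (Ω E : Type) (mΩ : MeasurableSpace Ω) (μ : Measure Ω) [IsProbabilityMeasure μ]
    [NormedAddCommGroup E] [InnerProductSpace ℝ E] [CompleteSpace E]
    (ℱ : Filtration ℕ mΩ) (f g : ℕ → Ω → E),
    Martingale f ℱ μ → Martingale g ℱ μ → IsDifferentiallySubordinate f g →
    (∀ n ω, ‖f n ω‖ ≤ 1) →
    ∀ lam : ℝ, 2 < lam →
      μ {ω | ∃ n, lam ≤ ‖g n ω‖} ≤ ENNReal.ofReal (burkholderAlpha * Real.exp (-lam))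

/-- **The key function of the proof of Thm. 8.1** (LNM 1464, §8, (8.5)–(8.7) and the concavity
step of the proof of (8.10)). Let `H` be a real Hilbert space of real dimension at least two,
`λ > 2`, `u = burkholderU λ`, and let `f, g` be `H`-valued martingales w.r.t. the same filtration
with `g` differentially subordinate to `f` and `‖f‖_∞ ≤ 1`. Then (8.6)
`E u(f_n, g_n) ≤ E u(f_{n-1}, g_{n-1})` for `n ≥ 1`, (8.7) `E u(f_0, g_0) ≤ αe^{-λ}`; and, for
`(x, y), (x + h, y + k) ∈ S = {‖x‖ ≤ 1}` with `‖k‖ < ‖h‖`, the function `G(t) = u(x + th, y + tk)`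
is concave on `I = {t : ‖x + th‖ ≤ 1}` ("The function `G` is concave on `I`", proof of (8.10);
with `k = 0` this is the concavity of `u(·, y)` along segments of the unit ball).
Users take `(h : Burkholder1991_keyFunction)`.
[cite: Burkholder1991, §8, proof of (8.1): (8.5)–(8.7), (8.14)–(8.16)] -/
def Burkholder1991_keyFunction : Prop :=
  ∀ (E : Type) [NormedAddCommGroup E] [InnerProductSpace ℝ E] [CompleteSpace E],
    (∃ v w : E, LinearIndependent ℝ ![v, w]) →
    ∀ lam : ℝ, 2 < lam →
      (∀ (Ω : Type) (mΩ : MeasurableSpace Ω) (μ : Measure Ω) [IsProbabilityMeasure μ]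
          (ℱ : Filtration ℕ mΩ) (f g : ℕ → Ω → E),
          Martingale f ℱ μ → Martingale g ℱ μ → IsDifferentiallySubordinate f g →
          (∀ n ω, ‖f n ω‖ ≤ 1) →
          (∀ n, ∫ ω, burkholderU lam (f (n + 1) ω) (g (n + 1) ω) ∂μ ≤
              ∫ ω, burkholderU lam (f n ω) (g n ω) ∂μ) ∧
            ∫ ω, burkholderU lam (f 0 ω) (g 0 ω) ∂μ ≤ burkholderAlpha * Real.exp (-lam)) ∧
      (∀ x y h k : E, ‖x‖ ≤ 1 → ‖x + h‖ ≤ 1 → ‖k‖ < ‖h‖ →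
          ConcaveOn ℝ {t : ℝ | ‖x + t • h‖ ≤ 1} (fun t => burkholderU lam (x + t • h) (y + t • k)))


/-! ## Monotonicity of `u(0, ·)` in `‖y‖` -/

section ZeroSection

variable {E : Type*} [NormedAddCommGroup E]

/-- The profile of `u_λ(0, y)` as a function of `s = ‖y‖`. [folklore] -/
private def zeroProfile (lam s : ℝ) : ℝ :=
  if lam ^ 2 - 1 < s ^ 2 then 1
  else if lam - 1 ≤ s then 1 - (lam ^ 2 - 1 - s ^ 2) / (4 * (lam - 1))
  else if 1 ≤ s then 2 * burkholderAlpha * Real.exp (s - lam - 1)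
  else burkholderAlpha * (1 + s ^ 2) * Real.exp (-lam)

/-- `u_λ(0, y)` is the profile at `‖y‖`. [folklore] -/
private theorem burkholderU_zero_left (lam : ℝ) (y : E) :
    burkholderU lam (0 : E) y = zeroProfile lam ‖y‖ := by
  unfold burkholderU zeroProfile
  rw [norm_zero, if_neg (by norm_num)]
  simp only [zero_pow two_ne_zero, add_zero, sub_zero, mul_one, zero_add]
  by_cases h4 : lam ^ 2 - 1 < ‖y‖ ^ 2
  · rw [if_pos h4, if_pos h4]
  · rw [if_neg h4, if_neg h4]
    by_cases h3 : lam - 1 ≤ ‖y‖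
    · rw [if_pos h3, if_pos h3]
    · rw [if_neg h3, if_neg h3, if_neg h3]

/-- `2α e^{-2} = 1/2`. [folklore] -/
private theorem two_alpha_exp_neg_two : 2 * burkholderAlpha * Real.exp (-2) = 1 / 2 := by
  unfold burkholderAlpha
  rw [Real.exp_neg]
  have h : Real.exp 2 ≠ 0 := (Real.exp_pos 2).ne'
  field_simp
  ring

/-- `2α e^{-λ} ≤ 1/2` for `λ ≥ 2`. [folklore] -/
private theorem two_alpha_exp_neg_le {lam : ℝ} (hlam : 2 ≤ lam) :
    2 * burkholderAlpha * Real.exp (-lam) ≤ 1 / 2 := by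
  calc 2 * burkholderAlpha * Real.exp (-lam) ≤ 2 * burkholderAlpha * Real.exp (-2) :=
        mul_le_mul_of_nonneg_left (Real.exp_le_exp.2 (by linarith))
          (mul_nonneg (by norm_num) burkholderAlpha_pos.le)
    _ = 1 / 2 := two_alpha_exp_neg_two

/-- The profile is nondecreasing on `[0, ∞)`. [folklore] -/
private theorem zeroProfile_mono {lam : ℝ} (hlam : 2 < lam) {s s' : ℝ} (hs : 0 ≤ s)
    (hss : s ≤ s') : zeroProfile lam s ≤ zeroProfile lam s' := by
  have hα := burkholderAlpha_pos
  have hl1 : 0 < lam - 1 := by linarith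
  have hs' : 0 ≤ s' := hs.trans hss
  -- values of the pieces
  have P0_le : ∀ t, 0 ≤ t → t < 1 → burkholderAlpha * (1 + t ^ 2) * Real.exp (-lam) ≤
      2 * burkholderAlpha * Real.exp (-lam) := by
    intro t ht0 ht1
    have ht2 : 1 + t ^ 2 ≤ 2 := by nlinarith
    have hαe : 0 ≤ burkholderAlpha * Real.exp (-lam) := by positivity
    calc burkholderAlpha * (1 + t ^ 2) * Real.exp (-lam)
        = burkholderAlpha * Real.exp (-lam) * (1 + t ^ 2) := by ring
      _ ≤ burkholderAlpha * Real.exp (-lam) * 2 := mul_le_mul_of_nonneg_left ht2 hαe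
      _ = 2 * burkholderAlpha * Real.exp (-lam) := by ring
  have P1_le : ∀ t, t < lam - 1 → 2 * burkholderAlpha * Real.exp (t - lam - 1) ≤ 1 / 2 := by
    intro t ht
    calc 2 * burkholderAlpha * Real.exp (t - lam - 1) ≤ 2 * burkholderAlpha * Real.exp (-2) :=
          mul_le_mul_of_nonneg_left (Real.exp_le_exp.2 (by linarith)) (by positivity)
      _ = 1 / 2 := two_alpha_exp_neg_two
  have P3_ge : ∀ t, lam - 1 ≤ t → 1 / 2 ≤ 1 - (lam ^ 2 - 1 - t ^ 2) / (4 * (lam - 1)) := by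
    intro t ht
    have h1 : (lam ^ 2 - 1 - t ^ 2) / (4 * (lam - 1)) ≤ 1 / 2 := by
      rw [div_le_iff₀ (by positivity)]
      nlinarith
    linarith
  have P3_le : ∀ t, ¬ (lam ^ 2 - 1 < t ^ 2) → 1 - (lam ^ 2 - 1 - t ^ 2) / (4 * (lam - 1)) ≤ 1 := by
    intro t ht
    have : 0 ≤ (lam ^ 2 - 1 - t ^ 2) / (4 * (lam - 1)) := div_nonneg (by linarith [not_lt.1 ht]) (by positivity)
    linarith
  have all_le_one : ∀ t, 0 ≤ t → zeroProfile lam t ≤ 1 := by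
    intro t ht
    unfold zeroProfile
    split_ifs with h4 h3 h1
    · exact le_rfl
    · exact P3_le t h4
    · linarith [P1_le t (not_le.1 h3)]
    · linarith [P0_le t ht (not_le.1 h1), two_alpha_exp_neg_le hlam.le]
  -- case analysis on the piece of `s'`
  by_cases h4' : lam ^ 2 - 1 < s' ^ 2
  · have : zeroProfile lam s' = 1 := by unfold zeroProfile; rw [if_pos h4']
    rw [this]; exact all_le_one s hs
  have h4 : ¬ (lam ^ 2 - 1 < s ^ 2) := fun h => h4' (lt_of_lt_of_le h (by nlinarith))
  by_cases h3' : lam - 1 ≤ s'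
  · have e' : zeroProfile lam s' = 1 - (lam ^ 2 - 1 - s' ^ 2) / (4 * (lam - 1)) := by
      unfold zeroProfile; rw [if_neg h4', if_pos h3']
    rw [e']
    unfold zeroProfile
    rw [if_neg h4]
    split_ifs with h3 h1
    · -- both in `P3`: monotone in `t²`
      have : s ^ 2 ≤ s' ^ 2 := by nlinarith
      have h := div_le_div_of_nonneg_right (c := 4 * (lam - 1))
        (show lam ^ 2 - 1 - s' ^ 2 ≤ lam ^ 2 - 1 - s ^ 2 by linarith) (by positivity)
      linarith
    · exact (P1_le s (not_le.1 h3)).trans (P3_ge s' h3')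
    · exact ((P0_le s hs (not_le.1 h1)).trans (two_alpha_exp_neg_le hlam.le)).trans (P3_ge s' h3')
  have h3 : ¬ (lam - 1 ≤ s) := fun h => h3' (h.trans hss)
  by_cases h1' : 1 ≤ s'
  · have e' : zeroProfile lam s' = 2 * burkholderAlpha * Real.exp (s' - lam - 1) := by
      unfold zeroProfile; rw [if_neg h4', if_neg h3', if_pos h1']
    rw [e']
    unfold zeroProfile
    rw [if_neg h4, if_neg h3]
    split_ifs with h1
    · exact mul_le_mul_of_nonneg_left (Real.exp_le_exp.2 (by linarith)) (by positivity)
    · calc burkholderAlpha * (1 + s ^ 2) * Real.exp (-lam) ≤ 2 * burkholderAlpha * Real.exp (-lam) :=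
            P0_le s hs (not_le.1 h1)
        _ ≤ 2 * burkholderAlpha * Real.exp (s' - lam - 1) :=
            mul_le_mul_of_nonneg_left (Real.exp_le_exp.2 (by linarith)) (by positivity)
  have h1 : ¬ (1 ≤ s) := fun h => h1' (h.trans hss)
  have e' : zeroProfile lam s' = burkholderAlpha * (1 + s' ^ 2) * Real.exp (-lam) := by
    unfold zeroProfile; rw [if_neg h4', if_neg h3', if_neg h1']
  have e : zeroProfile lam s = burkholderAlpha * (1 + s ^ 2) * Real.exp (-lam) := by
    unfold zeroProfile; rw [if_neg h4, if_neg h3, if_neg h1]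
  rw [e, e']
  have : 1 + s ^ 2 ≤ 1 + s' ^ 2 := by nlinarith
  exact mul_le_mul_of_nonneg_right (mul_le_mul_of_nonneg_left this hα.le) (Real.exp_pos _).le

/-- **`u_λ(0, y)` is nondecreasing in `‖y‖`** (`λ > 2`): an elementary property of the printed
closed forms of Burkholder's majorant at `x = 0` (`α(1+‖y‖²)e^{-λ}`, `2αe^{‖y‖-λ-1}`,
`1 - (λ²-1-‖y‖²)/(4(λ-1))`, `1`, glued continuously since `α = e²/4`).
[cite: Burkholder1991, §8, proof of (8.1), display after (8.8) (the formulas at `x = 0`)] -/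
theorem burkholderU_zero_mono {lam : ℝ} (hlam : 2 < lam) {y y' : E} (h : ‖y‖ ≤ ‖y'‖) :
    burkholderU lam (0 : E) y ≤ burkholderU lam (0 : E) y' := by
  rw [burkholderU_zero_left, burkholderU_zero_left]
  exact zeroProfile_mono hlam (norm_nonneg _) h

/-- `0 ≤ u_λ(0, y) ≤ 1` (`λ > 2`). [cite: Burkholder1991, §8, proof of (8.1), display after (8.8)] -/
theorem burkholderU_zero_mem_Icc {lam : ℝ} (hlam : 2 < lam) (y : E) :
    burkholderU lam (0 : E) y ∈ Icc (0 : ℝ) 1 := by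
  constructor
  · have h0 : burkholderU lam (0 : E) (0 : E) ≤ burkholderU lam (0 : E) y :=
      burkholderU_zero_mono hlam (by simp)
    refine le_trans ?_ h0
    rw [burkholderU_zero_zero hlam]
    exact mul_nonneg burkholderAlpha_pos.le (Real.exp_pos _).le
  · rw [burkholderU_zero_left]
    have hα := burkholderAlpha_pos
    unfold zeroProfile
    split_ifs with h4 h3 h1
    · exact le_rfl
    · have : 0 ≤ (lam ^ 2 - 1 - ‖y‖ ^ 2) / (4 * (lam - 1)) :=
        div_nonneg (by linarith [not_lt.1 h4]) (by linarith)
      linarith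
    · calc 2 * burkholderAlpha * Real.exp (‖y‖ - lam - 1) ≤ 2 * burkholderAlpha * Real.exp (-2) :=
            mul_le_mul_of_nonneg_left (Real.exp_le_exp.2 (by linarith [not_le.1 h3])) (by positivity)
        _ = 1 / 2 := two_alpha_exp_neg_two
        _ ≤ 1 := by norm_num
    · have ht2 : 1 + ‖y‖ ^ 2 ≤ 2 := by nlinarith [norm_nonneg y, not_le.1 h1]
      have hαe : 0 ≤ burkholderAlpha * Real.exp (-lam) := by positivity
      calc burkholderAlpha * (1 + ‖y‖ ^ 2) * Real.exp (-lam)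
          = burkholderAlpha * Real.exp (-lam) * (1 + ‖y‖ ^ 2) := by ring
        _ ≤ burkholderAlpha * Real.exp (-lam) * 2 := mul_le_mul_of_nonneg_left ht2 hαe
        _ = 2 * burkholderAlpha * Real.exp (-lam) := by ring
        _ ≤ 1 / 2 := two_alpha_exp_neg_le hlam.le
        _ ≤ 1 := by norm_num

end ZeroSection


/-! ## `0 ≤ u ≤ 1` on `S` -/

section Range

variable {E : Type*} [NormedAddCommGroup E]

/-- **`0 ≤ u_λ ≤ 1` on `S = {‖x‖ ≤ 1}`** (`λ > 2`; the majorant takes values in `[0, 1]`, as each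
printed piece does on its region). [cite: Burkholder1991, §8, proof of (8.1), display after (8.8)] -/
theorem burkholderU_mem_Icc {lam : ℝ} (hlam : 2 < lam) {x : E} (hx : ‖x‖ ≤ 1) (y : E) :
    burkholderU lam x y ∈ Icc (0 : ℝ) 1 := by
  have hα := burkholderAlpha_pos
  have hx0 := norm_nonneg x
  have hy0 := norm_nonneg y
  unfold burkholderU
  by_cases h1 : ‖x‖ = 1
  · rw [if_pos h1]; split_ifs <;> simp
  rw [if_neg h1]
  have hx1 : ‖x‖ < 1 := lt_of_le_of_ne hx h1
  have hx2 : ‖x‖ ^ 2 < 1 := by nlinarith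
  split_ifs with h4 h3 h2 h11
  · simp
  · -- `D₃`: `0 ≤ (λ²-1-‖y‖²+‖x‖²)/(4(λ-1)) ≤ (1-‖x‖)/2`
    have hnum0 : 0 ≤ lam ^ 2 - 1 - ‖y‖ ^ 2 + ‖x‖ ^ 2 := by linarith [not_lt.1 h4]
    have hnum1 : lam ^ 2 - 1 - ‖y‖ ^ 2 + ‖x‖ ^ 2 ≤ 2 * (lam - 1) * (1 - ‖x‖) := by nlinarith
    have hden : 0 < 4 * (lam - 1) := by linarith
    constructor
    · rw [sub_nonneg, div_le_one hden]; nlinarith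
    · have : 0 ≤ (lam ^ 2 - 1 - ‖y‖ ^ 2 + ‖x‖ ^ 2) / (4 * (lam - 1)) := div_nonneg hnum0 hden.le
      linarith
  · -- `D₂`
    have hden : 0 < (lam - ‖y‖) ^ 2 + 1 - ‖x‖ ^ 2 := by nlinarith [sq_nonneg (lam - ‖y‖)]
    constructor
    · exact div_nonneg (by linarith) hden.le
    · rw [div_le_one hden]; nlinarith [sq_nonneg (lam - ‖y‖)]
  · -- `D₁`
    constructor
    · have : 0 ≤ 1 - ‖x‖ := by linarith
      positivity
    · have hexp : Real.exp (‖x‖ + ‖y‖ - lam - 1) ≤ Real.exp (-2) :=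
        Real.exp_le_exp.2 (by linarith [not_le.1 h2])
      calc 2 * burkholderAlpha * (1 - ‖x‖) * Real.exp (‖x‖ + ‖y‖ - lam - 1)
          ≤ 2 * burkholderAlpha * 1 * Real.exp (-2) := by
            gcongr
            · linarith
        _ = 1 / 2 := by rw [mul_one]; exact two_alpha_exp_neg_two
        _ ≤ 1 := by norm_num
  · -- `D₀`
    have hxy : ‖x‖ + ‖y‖ < 1 := not_le.1 h11
    have hy1 : ‖y‖ ^ 2 ≤ 1 := by nlinarith
    constructor
    · have : 0 ≤ 1 + ‖y‖ ^ 2 - ‖x‖ ^ 2 := by nlinarith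
      positivity
    · have hαe : 0 ≤ burkholderAlpha * Real.exp (-lam) := by positivity
      calc burkholderAlpha * (1 + ‖y‖ ^ 2 - ‖x‖ ^ 2) * Real.exp (-lam)
          = burkholderAlpha * Real.exp (-lam) * (1 + ‖y‖ ^ 2 - ‖x‖ ^ 2) := by ring
        _ ≤ burkholderAlpha * Real.exp (-lam) * 2 :=
            mul_le_mul_of_nonneg_left (by nlinarith) hαe
        _ = 2 * burkholderAlpha * Real.exp (-lam) := by ring
        _ ≤ 1 / 2 := two_alpha_exp_neg_le hlam.le
        _ ≤ 1 := by norm_num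

end Range

end Literature.Probability.Process

end
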